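import Literature.AlgebraicGeometry.Motives.Correspondences
import HarnessLib

/-!
# Homological versus numerical equivalence: the two forms of `D(X)` agree (proofs)

This file discharges the named fact
`Literature.AlgebraicGeometry.Motives.WeilCohomology.standardConjectureD_iff_isNumericallyTrivial`
of `Literature.AlgebraicGeometry.Motives.Correspondences`: for a Weil cohomology theory `W` and
any `X` (thought of as smooth projective of dimension `n`), Grothendieck's standard conjecture
`D(X)` in Kleiman's abstract pairing form (`W.StandardConjectureD n X`: the cup-product pairing
`Aᵖ(X)_ℚ × A^{n-p}(X)_ℚ → K` has trivial left kernel) is equivalent to the statement with cycles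
"every numerically trivial codimension-`p` cycle (`p ≤ n`) is homologically trivial"
(Kleiman, *Algebraic cycles and the Weil conjectures* (1968) §3; Kleiman, *The standard
conjectures* (1994) §5).

The proof is the elementary one indicated in the fact's docstring: the lattice `Aᵖ(X)` of
algebraic classes is exactly the set of classes `γ(c)` of (finitely supported) codimension-`p`
cycles (`PreWeilCohomology.exists_cycleMap_eq_of_mem_algebraicLattice`, by closure induction
from `γ([closure {z}]) = cl(z)` — the public form of that identity is
`PreWeilCohomology.cycleMap_primeCycle` in `WeilCohomologyProofs`, whose heavy dimension-theory
imports are not wanted here, so a private copy is used), the group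
`W.ratAlgebraicClasses X p = Aᵖ(X)_ℚ` is its divisible hull, the pairing is biadditive, and `K`
has characteristic zero. No axiom of `WeilCohomology` is used (in particular neither the
smoothness hypothesis nor compactness of `X`: the cycles produced are finitely supported by
construction, so additivity of the `finsum` defining `W.cycleMap` is unconditional).

The conjecture `D(X)` itself (`W.StandardConjectureD`, `W.HomNumStandardConjecture`) is an
**open problem** and is of course not proved here.

## Main statements

* `PreWeilCohomology.exists_cycleMap_eq_of_mem_algebraicLattice`: every `x ∈ Aᵖ(X)` is `γ(c)`
  for a finitely supported codimension-`p` cycle `c`.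
* `WeilCohomology.standardConjectureD_iff_isNumericallyTrivial_holds`: the discharge.

## References

* S. Kleiman, *Algebraic cycles and the Weil conjectures*, in: Dix exposés sur la cohomologie
  des schémas, North-Holland (1968), 359–386, §3.
* S. Kleiman, *The standard conjectures*, in: Motives (Seattle 1991), Proc. Sympos. Pure Math.
  55, Part 1 (1994), 3–20, §5.
-/

universe u v

open CategoryTheory AlgebraicGeometry

noncomputable section

namespace Literature.AlgebraicGeometry.Motives

namespace PreWeilCohomology

variable {k : Type u} [Field k] {K : Type v} [Field K] (W : PreWeilCohomology k K)
variable (X : SchemeOver k) (p : ℕ)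

/-- The prime cycle `[closure {z}]` is supported in `{z}` (so it is finitely supported).
[folklore] -/
lemma support_primeCycle_subset (z : X.left) :
    Function.support (primeCycle z) ⊆ {z} := by
  intro z' hz'
  by_contra h
  exact hz' (primeCycle_apply_of_ne h)

/-- Private copy of `PreWeilCohomology.cycleMap_primeCycle` (`WeilCohomologyProofs`):
`γ([closure {z}]) = cl(z)` (kept private to avoid importing `CyclesDimensionProofs`). [folklore] -/
private lemma cycleMap_primeCycle' (z : X.left) :
    W.cycleMap X p (primeCycle z) = W.cycleClass X p z := by
  rw [cycleMap, finsum_eq_single (fun z' ↦ primeCycle z z' • W.cycleClass X p z') z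
    (fun z' hz' ↦ by rw [primeCycle_apply_of_ne hz', zero_smul])]
  simp only [primeCycle_apply_self, one_smul]

/-- `W.cycleMap` is additive on finitely supported cycles (no compactness of `X` needed).
[folklore] -/
lemma cycleMap_add_of_finite {c c' : AlgebraicCycle X.left ℤ}
    (hc : (Function.support c).Finite) (hc' : (Function.support c').Finite) :
    W.cycleMap X p (c + c') = W.cycleMap X p c + W.cycleMap X p c' := by
  simp only [cycleMap, Function.locallyFinsuppWithin.coe_add, Pi.add_apply, add_smul]
  exact finsum_add_distrib (hc.subset (Function.support_smul_subset_left (⇑c) (W.cycleClass X p)))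
    (hc'.subset (Function.support_smul_subset_left (⇑c') (W.cycleClass X p)))

/-- `W.cycleMap` commutes with negation: `γ(-c) = -γ(c)`. [folklore] -/
lemma cycleMap_neg (c : AlgebraicCycle X.left ℤ) :
    W.cycleMap X p (-c) = -W.cycleMap X p c := by
  simp only [cycleMap, Function.locallyFinsuppWithin.coe_neg, Pi.neg_apply, neg_smul]
  exact finsum_neg_distrib _

/-- **The algebraic lattice consists of cycle classes**: every `x ∈ Aᵖ(X)` (the subgroup of
`H²ᵖ(X)` generated by the classes of codimension-`p` points) is the class `γ(c)` of a finitely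
supported codimension-`p` cycle `c` (Kleiman 1968 §1.2 (C), §1.4: `Aᵖ(X)` is the image of
`Zᵖ(X)`). [folklore] -/
lemma exists_cycleMap_eq_of_mem_algebraicLattice {x : W.obj X (2 * p)}
    (hx : x ∈ W.algebraicLattice X p) :
    ∃ c ∈ cyclesOfCodim X.left p, (Function.support c).Finite ∧ W.cycleMap X p c = x := by
  refine AddSubgroup.closure_induction (fun y hy ↦ ?_) ?_ (fun y y' _ _ hy hy' ↦ ?_)
    (fun y _ hy ↦ ?_) hx
  · obtain ⟨⟨z, hz⟩, rfl⟩ := hy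
    exact ⟨primeCycle z, primeCycle_mem_cyclesOfCodim hz,
      (Set.finite_singleton z).subset (support_primeCycle_subset X z),
      W.cycleMap_primeCycle' X p z⟩
  · exact ⟨0, zero_mem _, by simp, W.cycleMap_zero X p⟩
  · obtain ⟨c, hc, hcf, rfl⟩ := hy
    obtain ⟨c', hc', hcf', rfl⟩ := hy'
    refine ⟨c + c', add_mem hc hc', (hcf.union hcf').subset ?_,
      W.cycleMap_add_of_finite X p hcf hcf'⟩
    rw [Function.locallyFinsuppWithin.coe_add]
    exact Function.support_add _ _
  · obtain ⟨c, hc, hcf, rfl⟩ := hy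
    refine ⟨-c, neg_mem hc, hcf.subset ?_, W.cycleMap_neg X p c⟩
    intro z hz
    simpa [Function.locallyFinsuppWithin.coe_neg] using hz

/-- Every rational algebraic class `x ∈ Aᵖ(X)_ℚ` has a nonzero integer multiple `N • x = γ(c)`
which is the class of a codimension-`p` cycle. [folklore] -/
lemma exists_cycleMap_eq_zsmul_of_mem_ratAlgebraicClasses {x : W.obj X (2 * p)}
    (hx : x ∈ W.ratAlgebraicClasses X p) :
    ∃ N : ℤ, N ≠ 0 ∧ ∃ c ∈ cyclesOfCodim X.left p, W.cycleMap X p c = N • x := by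
  obtain ⟨N, hN, hNx⟩ := hx
  obtain ⟨c, hc, -, hcx⟩ := W.exists_cycleMap_eq_of_mem_algebraicLattice X p hNx
  exact ⟨N, hN, c, hc, hcx⟩

end PreWeilCohomology

namespace WeilCohomology

variable {k : Type u} [Field k] {K : Type v} [Field K] [CharZero K] (W : WeilCohomology k K)
variable {n : ℕ} {X : SchemeOver k}

/-- **Discharge of `standardConjectureD_iff_isNumericallyTrivial`** (Kleiman 1968 §3, the
definition of `D(X)` and its reformulation "numerical equivalence implies homological
equivalence"; Kleiman 1994 §5): for every `X` (and any `n`), `W.StandardConjectureD n X` holds iff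
every numerically trivial codimension-`p` cycle, `p ≤ n`, is homologically trivial.

Proof. `(→)`: for `c ∈ Zᵖ(X)` numerically trivial, `γ(c) ∈ Aᵖ(X) ⊆ Aᵖ(X)_ℚ`; a class
`y ∈ A^q(X)_ℚ` (`p + q = n`) has `M • y = γ(c')` with `M ≠ 0`, so
`M • ⟨γ(c), y⟩ = ⟨γ(c), γ(c')⟩ = 0` and `⟨γ(c), y⟩ = 0` (`char K = 0`); `D(X)` gives `γ(c) = 0`.
`(←)`: for `x ∈ Aᵖ(X)_ℚ` pairing trivially with `A^q(X)_ℚ`, write `N • x = γ(c)`, `N ≠ 0`; then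
`c` is numerically trivial (`⟨N • x, γ(c')⟩ = N • ⟨x, γ(c')⟩ = 0`), hence `γ(c) = N • x = 0`, so
`x = 0`. The smoothness hypothesis is not needed. [cite: Kleiman1968, §3] -/
theorem standardConjectureD_iff_isNumericallyTrivial_holds :
    standardConjectureD_iff_isNumericallyTrivial (W := W) (n := n) (X := X) := by
  intro _hX
  constructor
  · intro hD p hp c hc hnum
    obtain ⟨q, hq⟩ : ∃ q, p + q = n := ⟨n - p, by omega⟩
    refine hD p q hq _ (W.algebraicLattice_le_ratAlgebraicClasses X p
      (W.cycleMap_mem_algebraicLattice X p hc)) fun y hy ↦ ?_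
    obtain ⟨M, hM, c', hc', hc'y⟩ := W.exists_cycleMap_eq_zsmul_of_mem_ratAlgebraicClasses X q hy
    have h0 := hnum q hq c' hc'
    rw [hc'y, map_zsmul, zsmul_eq_mul, mul_eq_zero] at h0
    exact h0.resolve_left (Int.cast_ne_zero.mpr hM)
  · intro H p q hq x hx hpair
    obtain ⟨N, hN, c, hc, hcx⟩ := W.exists_cycleMap_eq_zsmul_of_mem_ratAlgebraicClasses X p hx
    have hnum : W.IsNumericallyTrivial n X p c := by
      intro q' hq' c' hc'
      obtain rfl : q' = q := by omega
      rw [hcx, map_zsmul, LinearMap.smul_apply, hpair _ (W.algebraicLattice_le_ratAlgebraicClasses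
        X q' (W.cycleMap_mem_algebraicLattice X q' hc')), smul_zero]
    have h0 : W.cycleMap X p c = 0 := H p (by omega) c hc hnum
    rw [hcx, ← Int.cast_smul_eq_zsmul K N x, smul_eq_zero] at h0
    exact h0.resolve_left (Int.cast_ne_zero.mpr hN)

end WeilCohomology

end Literature.AlgebraicGeometry.Motives

end
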